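import Literature.Computability.FineGrained.NegativeTriangleToAPSPProgram
import Literature.Computability.FineGrained.SubcubicEquivalencesAPSP
import Literature.Computability.Cryptography.LayeredTriangleGraph
import HarnessLib

/-!
# Negative Triangle `≤₃` APSP (VW–W 2018, Thm. 1.1, (3) `≤₃` (1)): the verified reduction

This file discharges the named fact `negativeTriangle_fgReducible_APSP` of
`Literature.Computability.FineGrained.SubcubicEquivalencesAPSP` — one half of
`subcubicEquivalent_APSP_negativeTriangle` (`Literature.Computability.FineGrained.Conjectures`,
Vassilevska Williams–Williams, J. ACM 65 (2018), Thm. 1.1, (1) ⟺ (3)) — by assembling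

* the word-RAM oracle program `NegTriToAPSP.prog` and its phase-by-phase symbolic execution
  (`Literature.Computability.FineGrained.NegativeTriangleToAPSPProgram`),
* the layered triangle graph and its distance criterion for negative triangles
  (`Literature.Computability.Cryptography.LayeredTriangleGraph`), and
* the encoding and weight estimates of `SubcubicEquivalencesAPSP` / `GraphPathProblemsBounds`,

into `negativeTriangle_fgReducible_APSP_same c : FGReducible (NegativeTriangle c) (n ↦ n³) (APSP c)
(n ↦ n³)` (same weight exponent on both sides) and
**`negativeTriangle_fgReducible_APSP_holds : negativeTriangle_fgReducible_APSP`**.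

## The steps

1. `qseg_eq`: the segment handed to the oracle after loop A is *literally*
   `encodeMatrixWithTop (layeredTriangleGraph W)` (cell by cell: the offset decoders of loop A
   against `Fin.divNat`/`Fin.modNat` of the row-major encoding).
2. `layeredTriangleGraph_mem_APSP`: that graph is an `APSP c` instance of size `4 n` (weights
   `≤ nᶜ ≤ (4n)ᶜ`, acyclic hence no negative cycle), so an oracle answering `APSP c` returns
   `encodeMatrixWithTop (shortestDist (layeredTriangleGraph W))`, whose words are
   `≤ max (4n) (8 n^{c+1} + 1)` (`answer_entries_le`, distances lie in `[-4n·nᶜ, 4n·nᶜ]`).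
3. `flagC_eq_ite`: on that answer, loop C's flag is the indicator of `HasNegativeTriangle W`
   (`entry` reads the code of the distance from copy `0` of `t` to copy `3` of `t`; a code is nonzero
   and even iff it encodes a negative integer; `hasNegativeTriangle_iff_shortestDist_layeredTriangleGraph`).
4. `run_all`: the phases concatenate to a halting run of exactly `T n = 24 n² + 12 n + 34` steps with
   output `[flag]` and query log `[qseg W w]`.
5. Budgets (`negativeTriangle_fgReducible_APSP_same`): word size `w = (c + 7) · inputWidth`
   (`bnd_lt_capacity`, `answer_lt_capacity`: all addresses and answer words are `< (n² + 2)^{c+7}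
   ≤ 2 ^ w`); given `ε > 0` take `δ = min ε (1/3)` and `C = 70`: `T n ≤ 36 n² + 34 ≤ 70 (n³)^{1-δ} + 70`
   (`sq_le_budget`), the ledger of the single query `((4n)³)^{1-ε} ≤ 64 (n³)^{1-δ} + 1`
   (`ledger_le`), and its length `16 n² + 1 ≤ 70 (n³)^{1-δ} + 70`.

Everything here is proved; the program is deterministic and the reduction uses no randomness, as in
print (VW–W's reductions are deterministic except the optional variant of §4.3).

## References

* V. Vassilevska Williams, R. R. Williams, *Subcubic equivalences between path, matrix, and triangle
  problems*, J. ACM 65 (2018), Art. 27: Thm. 1.1 (p. 27:3), Def. 3.1 (p. 27:10), §4 and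
  Thm. 4.1 (p. 27:13–14), proof of Thm. 5.1 (p. 27:22, the product gadget). doi:10.1145/3186893
* V. Vassilevska Williams, *On some fine-grained questions in algorithms and complexity*, Proc. ICM
  2018, §2, Def. 2.1 (fine-grained reductions on the word RAM).
-/

namespace Literature.Computability.FineGrained

namespace NegTriToAPSP

open Cryptography Cryptography.WordRAM

/-! ### The query segment is the encoding of the layered triangle graph -/

section Query

variable {n : ℕ} (W : Matrix (Fin n) (Fin n) ℤ) {w : ℕ}

/-- Word `u N + v + 1` of an encoded `N × N` matrix is the code of the entry `(u, v)`. [folklore] -/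
theorem getElem_encodeMatrixWithTop_pair {N : ℕ} (G : Matrix (Fin N) (Fin N) (WithTop ℤ))
    (u v : Fin N) (h : (u : ℕ) * N + v + 1 < (encodeMatrixWithTop G).length) :
    (encodeMatrixWithTop G)[(u : ℕ) * N + v + 1] = encodeWithTopInt (G u v) := by
  rw [getElem_encodeMatrixWithTop_succ G _ (mul_add_lt_mul u.is_lt v.is_lt) h, divNat_mk_mul_add,
    modNat_mk_mul_add]

/-- The code of the entry of the layered triangle graph at row-major offset `m`, through the
decoders `lu, ia, lv, jb` of loop A: the arc value if the target is one layer above the source,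
`0` (no arc) otherwise. [folklore] -/
theorem encodeWithTopInt_layeredTriangleGraph {m : ℕ} (hm : m < 4 * n * (4 * n)) :
    encodeWithTopInt (layeredTriangleGraph W (Fin.divNat ⟨m, hm⟩) (Fin.modNat ⟨m, hm⟩)) =
      if lu n m + 1 = lv n m then arcVal W (ia n m) (jb n m) else 0 := by
  set u : Fin (4 * n) := Fin.divNat ⟨m, hm⟩ with hu
  set v : Fin (4 * n) := Fin.modNat ⟨m, hm⟩ with hv
  have hu1 : (u.divNat : ℕ) = lu n m := rfl
  have hv1 : (v.divNat : ℕ) = lv n m := rfl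
  have hu2 : (u.modNat : ℕ) = ia n m := rfl
  have hv2 : (v.modNat : ℕ) = jb n m := rfl
  rw [layeredTriangleGraph_apply, hu1, hv1]
  by_cases h1 : lu n m + 1 = lv n m
  · rw [if_pos h1]
    by_cases h2 : ia n m = jb n m
    · have h2' : u.modNat = v.modNat := Fin.ext (by rw [hu2, hv2, h2])
      rw [if_neg (fun h => h.2 h2'), arcVal, if_pos h2]
      rfl
    · have h2' : u.modNat ≠ v.modNat := fun h => h2 (by rw [← hu2, ← hv2, h])
      rw [if_pos ⟨h1, h2'⟩, arcVal, if_neg h2, code,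
        dif_pos (mul_add_lt_mul (hu2 ▸ u.modNat.is_lt) (hv2 ▸ v.modNat.is_lt))]
      have e1 : Fin.divNat ⟨ia n m * n + jb n m, mul_add_lt_mul (hu2 ▸ u.modNat.is_lt)
          (hv2 ▸ v.modNat.is_lt)⟩ = u.modNat := by
        simp_rw [← hu2, ← hv2]; exact divNat_mk_mul_add _ _ _
      have e2 : Fin.modNat ⟨ia n m * n + jb n m, mul_add_lt_mul (hu2 ▸ u.modNat.is_lt)
          (hv2 ▸ v.modNat.is_lt)⟩ = v.modNat := by
        simp_rw [← hu2, ← hv2]; exact modNat_mk_mul_add _ _ _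
      rw [e1, e2]
  · rw [if_neg h1, if_neg (fun h => h1 h.1)]
    rfl

/-- The cells of the query matrix after loop A: the arc value where the target is one layer above
the source, `0` elsewhere. [folklore] -/
theorem heapA_entry {m : ℕ} (hm : m < 4 * n * (4 * n)) :
    heapA W w (n * n) (Q n + (m + 1)) = if lu n m + 1 = lv n m then arcVal W (ia n m) (jb n m) else 0 := by
  have hn : 0 < n := Nat.pos_of_ne_zero (by rintro rfl; simp at hm)
  have hsub : Q n + (m + 1) - (Q n + 1) = m := by omega
  have hia : ia n m < n := Nat.mod_lt _ hn
  have hjb : jb n m < n := Nat.mod_lt _ hn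
  unfold heapA
  simp only [hsub]
  by_cases h1 : lu n m + 1 = lv n m
  · rw [if_pos ⟨by omega, by omega, h1, mul_add_lt_mul hia hjb⟩, if_pos h1]
  · rw [if_neg (fun h => h1 h.2.2.1), if_neg h1]
    unfold heap0
    rw [Function.update_of_ne (by omega), bootMem_apply_high W (by unfold Q; omega)]
    exact init_mem_of_lt W (by unfold Q F; omega)

/-- **The query is the layered triangle graph**: the segment handed to the APSP oracle is exactly
`encodeMatrixWithTop (layeredTriangleGraph W)`. [folklore] -/
theorem qseg_eq : qseg W w = encodeMatrixWithTop (layeredTriangleGraph W) := by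
  apply List.ext_getElem
  · rw [qseg, readSeg_length, encodeMatrixWithTop_length, LEN, sq]
  intro i h1 h2
  simp only [qseg, readSeg, List.getElem_map, List.getElem_range]
  cases i with
  | zero => rw [Nat.add_zero, heapA_Q, getElem_encodeMatrixWithTop_zero]
  | succ m =>
    have hm : m < 4 * n * (4 * n) := by
      rw [encodeMatrixWithTop_length, sq] at h2; omega
    rw [getElem_encodeMatrixWithTop_succ _ m hm h2, encodeWithTopInt_layeredTriangleGraph W hm,
      heapA_entry W hm]

end Query

/-! ### The flag computed by loop C detects a negative distance -/

/-- The word computed from an answer entry is `1` iff the entry is a nonzero even number (the code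
of a negative integer). [folklore] -/
theorem condVal_eq_one_iff (v : ℕ) : condVal v = 1 ↔ v ≠ 0 ∧ v % 2 = 0 := by
  unfold condVal
  rw [← Nat.and_one_is_mod]
  by_cases hv : v = 0
  · subst hv; simp
  · simp only [hv, if_false, ne_eq, not_false_eq_true, true_and, Nat.zero_or]
    constructor
    · intro h
      by_contra h'
      rw [if_neg h'] at h
      exact absurd h (by norm_num)
    · intro h
      rw [if_pos h]

/-- For words `≤ 1`, `a ||| b = 1` iff one of them is `1`. [folklore] -/
theorem or_eq_one_iff {a b : ℕ} (ha : a ≤ 1) (hb : b ≤ 1) : a ||| b = 1 ↔ a = 1 ∨ b = 1 := by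
  rcases Nat.le_one_iff_eq_zero_or_eq_one.1 ha with rfl | rfl <;>
    rcases Nat.le_one_iff_eq_zero_or_eq_one.1 hb with rfl | rfl <;> decide

/-- The flag after `t` iterations is `1` iff some entry read so far passed the test. [folklore] -/
theorem flagC_eq_one_iff (ans : List ℕ) (n : ℕ) :
    ∀ t, flagC ans n t = 1 ↔ ∃ s < t, condVal (entry ans n s) = 1
  | 0 => by simp [flagC]
  | t + 1 => by
      rw [flagC, or_eq_one_iff (flagC_le_one ans n t) (condVal_le_one _), flagC_eq_one_iff ans n t]
      constructor
      · rintro (⟨s, hs, h⟩ | h)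
        · exact ⟨s, Nat.lt_succ_of_lt hs, h⟩
        · exact ⟨t, Nat.lt_succ_self t, h⟩
      · rintro ⟨s, hs, h⟩
        rcases Nat.lt_succ_iff_lt_or_eq.1 hs with hs | rfl
        · exact Or.inl ⟨s, hs, h⟩
        · exact Or.inr h

/-- The entry read in iteration `t` of loop C from an encoded `4n × 4n` matrix is the code of the
entry (copy `0` of `t`, copy `3` of `t`). [folklore] -/
theorem entry_encodeMatrixWithTop {n : ℕ} (D : Matrix (Fin (4 * n)) (Fin (4 * n)) (WithTop ℤ))
    (t : Fin n) :
    entry (encodeMatrixWithTop D) n t = encodeWithTopInt (D (Fin.mkDivMod 0 t) (Fin.mkDivMod 3 t)) := by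
  have hidx : 1 + 3 * n + (t : ℕ) * (4 * n + 1) =
      ((Fin.mkDivMod (0 : Fin 4) t : Fin (4 * n)) : ℕ) * (4 * n) +
        ((Fin.mkDivMod (3 : Fin 4) t : Fin (4 * n)) : ℕ) + 1 := by
    simp only [Fin.coe_mkDivMod, Fin.val_zero]
    have : ((3 : Fin 4) : ℕ) = 3 := rfl
    rw [this]; ring
  have hlt : ((Fin.mkDivMod (0 : Fin 4) t : Fin (4 * n)) : ℕ) * (4 * n) +
      ((Fin.mkDivMod (3 : Fin 4) t : Fin (4 * n)) : ℕ) + 1 < (encodeMatrixWithTop D).length := by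
    rw [encodeMatrixWithTop_length, sq]
    have := mul_add_lt_mul (Fin.mkDivMod (0 : Fin 4) t).is_lt (Fin.mkDivMod (3 : Fin 4) t).is_lt
    omega
  rw [entry, hidx, List.getD_eq_getElem _ _ hlt, getElem_encodeMatrixWithTop_pair]

/-- **Correctness of loop C.** On the encoded distance matrix of the layered triangle graph, the final
flag is `1` iff `W` has a negative triangle. [folklore] -/
theorem flagC_eq_one_iff_hasNegativeTriangle {n : ℕ} (W : Matrix (Fin n) (Fin n) ℤ) :
    flagC (encodeMatrixWithTop (shortestDist (layeredTriangleGraph W))) n n = 1 ↔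
      HasNegativeTriangle W := by
  rw [flagC_eq_one_iff, hasNegativeTriangle_iff_shortestDist_layeredTriangleGraph]
  constructor
  · rintro ⟨s, hs, h⟩
    refine ⟨⟨s, hs⟩, ?_⟩
    rw [entry_encodeMatrixWithTop _ ⟨s, hs⟩, condVal_eq_one_iff,
      encodeWithTopInt_ne_zero_and_even_iff] at h
    exact h
  · rintro ⟨i, hi⟩
    refine ⟨i, i.is_lt, ?_⟩
    rw [show (i : ℕ) = ((⟨i, i.is_lt⟩ : Fin n) : ℕ) from rfl, entry_encodeMatrixWithTop _ ⟨i, i.is_lt⟩,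
      condVal_eq_one_iff, encodeWithTopInt_ne_zero_and_even_iff]
    exact hi

/-- The final flag is at most `1`, hence it is the indicator of `HasNegativeTriangle W`. [folklore] -/
theorem flagC_eq_ite {n : ℕ} (W : Matrix (Fin n) (Fin n) ℤ) [Decidable (HasNegativeTriangle W)] :
    flagC (encodeMatrixWithTop (shortestDist (layeredTriangleGraph W))) n n =
      if HasNegativeTriangle W then 1 else 0 := by
  have h1 := flagC_le_one (encodeMatrixWithTop (shortestDist (layeredTriangleGraph W))) n n
  have h2 := flagC_eq_one_iff_hasNegativeTriangle W
  split_ifs with h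
  · exact h2.2 h
  · rcases Nat.le_one_iff_eq_zero_or_eq_one.1 h1 with h0 | h0
    · exact h0
    · exact absurd (h2.1 h0) h

/-! ### The whole run -/

/-- The running time of the reduction on an `n`-vertex instance: `24 n² + 12 n + 34` steps. [folklore] -/
def T (n : ℕ) : ℕ := 24 * (n * n) + 12 * n + 34

section Run

variable {n : ℕ} (W : Matrix (Fin n) (Fin n) ℤ) {w : ℕ} (hw : inputWidth (inp W) ≤ w)
  (hB : bnd n ≤ 2 ^ w) (O : List ℕ → List ℕ)

include hw hB in
/-- **The complete run.** With an oracle whose answer to the (single) query has the length of an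
encoded `4n × 4n` matrix and word-sized entries, the program halts after exactly `T n` steps with
output cells `mem 0 = 1`, `mem 1 = flag`, having made the one query `qseg W w`. [folklore] -/
theorem run_all (hans : ∀ v ∈ O (qseg W w), v < 2 ^ w) (hlen : (O (qseg W w)).length = LEN n) :
    ∃ M : ℕ → ℕ, M 0 = 1 ∧ M 1 = flagC (O (qseg W w)) n n ∧
      run prog w O zeroCoins (T n) (init w (inp W)) = some ⟨none, M, 0, [qseg W w]⟩ := by
  set ans := O (qseg W w) with hans_def
  have h1 := run_boot W hw hB (O := O) (ρ := zeroCoins)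
  obtain ⟨R0, hR0, h2⟩ := run_setup W hB (O := O) (ρ := zeroCoins)
  obtain ⟨R1, hR1, h3⟩ := run_loopA W hw hB (O := O) (ρ := zeroCoins) (n * n) le_rfl hR0
  obtain ⟨R2, hR2, h4⟩ := run_loopA_exit (w := w) (O := O) (ρ := zeroCoins) hR1 (heapA W w (n * n))
  have h5 := run_query W (w := w) (O := O) (ρ := zeroCoins) hR2
  rw [map_mod_two_pow_eq_self hans] at h5
  obtain ⟨R3, hR3, h6⟩ := run_postq hB (O := O) (ρ := zeroCoins) ans (qs := [qseg W w]) hR2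
    (heapQ W w ans)
  obtain ⟨R4, hR4, h7⟩ := run_loopC W hB (O := O) (ρ := zeroCoins) ans hans hlen (qs := [qseg W w])
    n le_rfl hR3
  obtain ⟨R5, h50, h51, h8⟩ := run_finish hB (O := O) (ρ := zeroCoins) ans (qs := [qseg W w]) hR4
    (heapQ W w ans)
  refine ⟨mkMem R5 (heapQ W w ans), by simpa [mkMem_apply] using h50, by simpa [mkMem_apply] using h51, ?_⟩
  have e : T n = (((((((5 * (n * n) + 5) + 15) + 19 * (n * n)) + 2) + 1) + 6) + 12 * n) + 5 := by
    unfold T; ring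
  rw [e]
  refine run_add_of_run _ _ _ _ ?_ h8
  refine run_add_of_run _ _ _ _ ?_ h7
  refine run_add_of_run _ _ _ _ ?_ h6
  refine run_add_of_run _ _ _ _ ?_ h5
  refine run_add_of_run _ _ _ _ ?_ h4
  refine run_add_of_run _ _ _ _ ?_ h3
  exact run_add_of_run _ _ _ _ h1 h2

end Run


/-! ### The APSP instance and the budgets -/

section Instance

variable {n : ℕ} (W : Matrix (Fin n) (Fin n) ℤ)

/-- Monotonicity of `HasBoundedWeights` in the bound. [folklore] -/
theorem hasBoundedWeights_mono {ι : Type*} [Fintype ι] {G : Matrix ι ι (WithTop ℤ)} {M N : ℕ}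
    (h : HasBoundedWeights G M) (hMN : M ≤ N) : HasBoundedWeights G N :=
  fun i j => IsBddWeight.mono (h i j) hMN

/-- The layered triangle graph of a `NegativeTriangle c` instance is an `APSP c` instance: weights
bounded by `n ^ c ≤ (4 n) ^ c`, no negative cycle. [folklore] -/
theorem layeredTriangleGraph_mem_APSP (c : ℕ)
    (hW : HasBoundedWeights (W.map ((↑) : ℤ → WithTop ℤ)) (n ^ c)) :
    HasBoundedWeights (layeredTriangleGraph W) ((4 * n) ^ c) ∧
      HasNoNegativeCycle (layeredTriangleGraph W) :=
  ⟨hasBoundedWeights_mono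
      (hasBoundedWeights_layeredTriangleGraph W (forall_abs_le_of_hasBoundedWeights_map W hW))
      (Nat.pow_le_pow_left (by omega) c),
    hasNoNegativeCycle_layeredTriangleGraph W⟩

/-- The words of the oracle's answer (the encoded distance matrix of the layered triangle graph) are
at most `max (4 n) (8 n^{c+1} + 1)`. [folklore] -/
theorem answer_entries_le (c : ℕ) (hW : HasBoundedWeights (W.map ((↑) : ℤ → WithTop ℤ)) (n ^ c)) :
    ∀ v ∈ encodeMatrixWithTop (shortestDist (layeredTriangleGraph W)),
      v ≤ max (4 * n) (2 * (4 * n * n ^ c) + 1) := by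
  have hd := hasBoundedWeights_shortestDist
    (hasBoundedWeights_layeredTriangleGraph W (forall_abs_le_of_hasBoundedWeights_map W hW))
  rw [Fintype.card_fin] at hd
  exact forall_mem_encodeMatrixWithTop_le hd

/-- The key capacity estimate: `64 (n^{c+1} + 1) ≤ (n² + 2)^{c+7}`. [folklore] -/
theorem capacity_le (n c : ℕ) : 64 * (n ^ (c + 1) + 1) ≤ (n * n + 1 + 1) ^ (c + 7) := by
  have h1 : n ^ (c + 1) + 1 ≤ (n * n + 1 + 1) ^ (c + 1) := by
    have : n ^ (c + 1) < (n + 1) ^ (c + 1) := Nat.pow_lt_pow_left (Nat.lt_succ_self n) (by omega)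
    have : (n + 1) ^ (c + 1) ≤ (n * n + 1 + 1) ^ (c + 1) := Nat.pow_le_pow_left (by nlinarith) _
    omega
  have h2 : 64 ≤ (n * n + 1 + 1) ^ 6 := by
    calc (64 : ℕ) = 2 ^ 6 := by norm_num
      _ ≤ (n * n + 1 + 1) ^ 6 := Nat.pow_le_pow_left (by omega) 6
  calc 64 * (n ^ (c + 1) + 1) ≤ (n * n + 1 + 1) ^ 6 * (n * n + 1 + 1) ^ (c + 1) :=
        Nat.mul_le_mul h2 h1
    _ = (n * n + 1 + 1) ^ (c + 7) := by rw [← pow_add]; congr 1; omega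

/-- All register values fit: `bnd n = 40 (n² + 2) < (n² + 2)^{c+7}`. [folklore] -/
theorem bnd_lt_capacity (n c : ℕ) : bnd n < (n * n + 1 + 1) ^ (c + 7) := by
  have h2 : 64 ≤ (n * n + 1 + 1) ^ (c + 6) :=
    calc (64 : ℕ) = 2 ^ 6 := by norm_num
      _ ≤ 2 ^ (c + 6) := Nat.pow_le_pow_right (by norm_num) (by omega)
      _ ≤ (n * n + 1 + 1) ^ (c + 6) := Nat.pow_le_pow_left (by omega) _
  have : (n * n + 1 + 1) * 64 ≤ (n * n + 1 + 1) ^ (c + 7) := by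
    rw [pow_succ']
    exact Nat.mul_le_mul_left _ h2
  unfold bnd; omega

/-- The answer words fit: `max (4 n) (8 n^{c+1} + 1) < (n² + 2)^{c+7}`. [folklore] -/
theorem answer_lt_capacity (n c : ℕ) : max (4 * n) (2 * (4 * n * n ^ c) + 1) < (n * n + 1 + 1) ^ (c + 7) := by
  have h := capacity_le n c
  have hb := bnd_lt_capacity n c
  have hp : 4 * n * n ^ c = 4 * n ^ (c + 1) := by ring
  rw [hp]
  refine max_lt ?_ (by omega)
  unfold bnd at hb; nlinarith

end Instance


/-! ### The reduction -/

section Reduction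

/-- For `δ ≤ 1/3`: `n² ≤ (n³)^{1-δ}` (the sub-budget at `δ ≤ 1/3` dominates the quadratic running
time). [folklore] -/
theorem sq_le_budget {δ : ℝ} (hδ : δ ≤ 1 / 3) (n : ℕ) :
    (n : ℝ) * n ≤ ((n : ℝ) ^ (3 : ℝ)) ^ (1 - δ) := by
  rcases Nat.eq_zero_or_pos n with rfl | hn
  · rw [Nat.cast_zero, mul_zero]
    exact Real.rpow_nonneg (Real.rpow_nonneg le_rfl _) _
  · have h1 : (1 : ℝ) ≤ (n : ℝ) ^ (3 : ℝ) := Real.one_le_rpow (by exact_mod_cast hn) (by norm_num)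
    calc (n : ℝ) * n = ((n ^ 2 : ℕ) : ℝ) := by push_cast; ring
      _ = ((n : ℝ) ^ (3 : ℝ)) ^ (1 - 1 / 3 : ℝ) := (rpow_three_rpow_two_thirds n).symm
      _ ≤ ((n : ℝ) ^ (3 : ℝ)) ^ (1 - δ) := Real.rpow_le_rpow_of_exponent_le h1 (by linarith)

/-- The ledger estimate for the single query of size `4 n`: `((4n)³)^{1-ε} ≤ 64 (n³)^{1-δ} + 1`
whenever `0 ≤ ε` and `δ ≤ ε`. [folklore] -/
theorem ledger_le {ε δ : ℝ} (hε : 0 ≤ ε) (hδε : δ ≤ ε) (n : ℕ) :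
    (((4 * n : ℕ) : ℝ) ^ (3 : ℝ)) ^ (1 - ε) ≤ 64 * ((n : ℝ) ^ (3 : ℝ)) ^ (1 - δ) + 1 := by
  have h0 : (0 : ℝ) ≤ ((n : ℝ) ^ (3 : ℝ)) ^ (1 - δ) :=
    Real.rpow_nonneg (Real.rpow_nonneg (Nat.cast_nonneg _) _) _
  rcases Nat.eq_zero_or_pos n with rfl | hn
  · have e : (((4 * 0 : ℕ) : ℝ) ^ (3 : ℝ)) = 0 := by
      rw [Nat.mul_zero, Nat.cast_zero, Real.zero_rpow (by norm_num)]
    calc (((4 * 0 : ℕ) : ℝ) ^ (3 : ℝ)) ^ (1 - ε) = (0 : ℝ) ^ (1 - ε) := by rw [e]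
      _ ≤ 1 := Real.zero_rpow_le_one _
      _ ≤ 64 * (((0 : ℕ) : ℝ) ^ (3 : ℝ)) ^ (1 - δ) + 1 := by linarith [h0]
  · have hn1 : (1 : ℝ) ≤ n := by exact_mod_cast hn
    have ha : (1 : ℝ) ≤ (n : ℝ) ^ (3 : ℝ) := Real.one_le_rpow hn1 (by norm_num)
    have ha0 : (0 : ℝ) ≤ (n : ℝ) ^ (3 : ℝ) := le_trans zero_le_one ha
    have h64 : ((4 * n : ℕ) : ℝ) ^ (3 : ℝ) = 64 * (n : ℝ) ^ (3 : ℝ) := by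
      push_cast
      rw [Real.mul_rpow (by norm_num) (Nat.cast_nonneg n)]
      congr 1
      rw [show (3 : ℝ) = ((3 : ℕ) : ℝ) by norm_num, Real.rpow_natCast]
      norm_num
    rw [h64, Real.mul_rpow (by norm_num) ha0]
    have h1 : (64 : ℝ) ^ (1 - ε) ≤ 64 := by
      conv_rhs => rw [← Real.rpow_one 64]
      exact Real.rpow_le_rpow_of_exponent_le (by norm_num) (by linarith)
    have h2 : ((n : ℝ) ^ (3 : ℝ)) ^ (1 - ε) ≤ ((n : ℝ) ^ (3 : ℝ)) ^ (1 - δ) :=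
      Real.rpow_le_rpow_of_exponent_le ha (by linarith)
    have h3 : (0 : ℝ) ≤ ((n : ℝ) ^ (3 : ℝ)) ^ (1 - ε) := Real.rpow_nonneg ha0 _
    have := mul_le_mul h1 h2 h3 (by norm_num)
    linarith

/-- **VW–W 2018, Thm. 1.1, direction (3) `≤₃` (1), proved with the same weight exponent**: for
every `c`, Negative Triangle with weights in `[-nᶜ, nᶜ]` reduces to APSP with weights in
`[-Nᶜ, Nᶜ]` by the verified word-RAM program `prog` — one APSP query on the layered triangle graph
(`N = 4 n` vertices), `O(n²)` time, word size `(c + 7) · width`; for every `ε > 0` the definition of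
`FGReducible` is met with `δ = min ε (1/3)` and `C = 70`. In print the direction goes through matrix
product verification (Thm. 4.1, p. 27:14) and the classical encoding of a distance product as a
shortest-path computation (cf. the two-layer gadget with shifted weights in the proof of Thm. 5.1,
p. 27:22); the layered graph is this library's own fused rendering.
[cite: VassilevskaWilliamsWilliams2018, Thm. 1.1 ((3) ≤₃ (1)); cf. Thm. 4.1 (p. 27:14)] -/
theorem negativeTriangle_fgReducible_APSP_same (c : ℕ) :
    FGReducible (NegativeTriangle c) (fun n => (n : ℝ) ^ (3 : ℝ)) (APSP c)
      (fun n => (n : ℝ) ^ (3 : ℝ)) := by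
  intro ε hε
  refine ⟨min ε (1 / 3), lt_min hε (by norm_num), prog, c + 7, 70, prog_isDeterministic, ?_⟩
  intro O hO x
  obtain ⟨⟨n, W⟩, hWb⟩ := x
  change HasBoundedWeights (W.map ((↑) : ℤ → WithTop ℤ)) (n ^ c) at hWb
  have hδ3 : min ε (1 / 3) ≤ 1 / 3 := min_le_right _ _
  have hδε : min ε (1 / 3) ≤ ε := min_le_left _ _
  have hbud0 : (0 : ℝ) ≤ ((n : ℝ) ^ (3 : ℝ)) ^ (1 - min ε (1 / 3)) :=
    Real.rpow_nonneg (Real.rpow_nonneg (Nat.cast_nonneg _) _) _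
  have hsq := sq_le_budget hδ3 n
  -- the APSP instance queried
  let y : (APSP c).Inst := ⟨⟨4 * n, layeredTriangleGraph W⟩, layeredTriangleGraph_mem_APSP W c hWb⟩
  -- the word size
  set w : ℕ := (c + 7) * inputWidth (inp W) with hw_def
  have hw : inputWidth (inp W) ≤ w := inputWidth_le_mul (by omega) _
  have hcap : ∀ v, v < (n * n + 1 + 1) ^ (c + 7) → v < 2 ^ w := fun v hv =>
    lt_two_pow_mul_inputWidth (by rw [inp_length]; exact hv)
  have hB : bnd n ≤ 2 ^ w := (hcap _ (bnd_lt_capacity n c)).le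
  -- the oracle's answer
  have hans_eq : O (qseg W w) = encodeMatrixWithTop (shortestDist (layeredTriangleGraph W)) := by
    have := hO y
    rw [APSP_good, Set.mem_singleton_iff] at this
    rw [qseg_eq]
    exact this
  have hans : ∀ v ∈ O (qseg W w), v < 2 ^ w := by
    rw [hans_eq]
    intro v hv
    exact hcap v (lt_of_le_of_lt (answer_entries_le W c hWb v hv) (answer_lt_capacity n c))
  have hlen : (O (qseg W w)).length = LEN n := by
    rw [hans_eq, encodeMatrixWithTop_length, LEN, sq]
  obtain ⟨M, hM0, hM1, hrun⟩ := run_all W hw hB O hans hlen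
  refine ⟨⟨none, M, 0, [qseg W w]⟩, [y], ?_, ?_, ?_, ?_, ?_⟩
  · -- the run halts within the budget
    refine haltsWithin_of_run hrun (step_of_pc_eq_none rfl) (Nat.le_floor ?_)
    change ((T n : ℕ) : ℝ) ≤ 70 * ((n : ℝ) ^ (3 : ℝ)) ^ (1 - min ε (1 / 3)) + 70
    have hnn : (n : ℝ) ≤ (n : ℝ) * n := by exact_mod_cast Nat.le_mul_self n
    have hT : ((T n : ℕ) : ℝ) = 24 * ((n : ℝ) * n) + 12 * n + 34 := by unfold T; push_cast; ring
    rw [hT]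
    nlinarith
  · -- the output is the accepted one
    change readOut M ∈ (FGProblem.ofPred
      (fun W : Σ n, Matrix (Fin n) (Fin n) ℤ => encodeMatrixWithTop (W.2.map (↑))) (·.1)
      (fun W : Σ n, Matrix (Fin n) (Fin n) ℤ => HasNegativeTriangle W.2)).Good ⟨n, W⟩
    have hout : readOut M = [M 1] := by simp [readOut, readSeg, hM0]
    classical
    rw [hout, hM1, hans_eq, flagC_eq_ite W]
    by_cases h : HasNegativeTriangle W
    · rw [if_pos h, FGProblem.ofPred_good_of_pos _ _
        (fun W : Σ n, Matrix (Fin n) (Fin n) ℤ => HasNegativeTriangle W.2) ⟨n, W⟩ h]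
      exact Set.mem_singleton _
    · rw [if_neg h, FGProblem.ofPred_good_of_neg _ _
        (fun W : Σ n, Matrix (Fin n) (Fin n) ℤ => HasNegativeTriangle W.2) ⟨n, W⟩ h]
      exact Set.mem_singleton _
  · -- the query log lists the encodings of the queried instances
    change [qseg W w] = [encodeMatrixWithTop (layeredTriangleGraph W)]
    rw [qseg_eq]
  · -- the ledger of Def. 2.1
    simp only [List.map_cons, List.map_nil, List.sum_cons, List.sum_nil, add_zero]
    change (((4 * n : ℕ) : ℝ) ^ (3 : ℝ)) ^ (1 - ε) ≤ 70 * ((n : ℝ) ^ (3 : ℝ)) ^ (1 - min ε (1 / 3)) + 70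
    have := ledger_le hε.le hδε n
    linarith
  · -- the total query length
    simp only [List.map_cons, List.map_nil, List.sum_cons, List.sum_nil, add_zero]
    change (((encodeMatrixWithTop (layeredTriangleGraph W)).length : ℕ) : ℝ) ≤
      70 * ((n : ℝ) ^ (3 : ℝ)) ^ (1 - min ε (1 / 3)) + 70
    rw [encodeMatrixWithTop_length]
    push_cast
    nlinarith

end Reduction

end NegTriToAPSP

/-- **Discharge of `negativeTriangle_fgReducible_APSP`** (VW–W 2018, Thm. 1.1, (3) `≤₃` (1)): take
`c' = c`. [cite: VassilevskaWilliamsWilliams2018, Thm. 1.1 ((3) ≤₃ (1))] -/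
theorem negativeTriangle_fgReducible_APSP_holds : negativeTriangle_fgReducible_APSP :=
  fun c => ⟨c, NegTriToAPSP.negativeTriangle_fgReducible_APSP_same c⟩

end Literature.Computability.FineGrained
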